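import Literature.Barriers.QuantumAdvantage.BoundedEntanglementSplitting
import Literature.Computability.QuantumComplexity.CircuitEmbedding
import Literature.Computability.Cryptography.QuantumCircuitProofs
import Literature.Computability.Cryptography.QubitRegisterCliffordTProofs
import HarnessLib

/-!
# Locality of placed gates for splitting sets; the states of a `p`-blocked computation step by step

Topic `Literature/Barriers/QuantumAdvantage`; second file of the proof programme for the named
fact `Literature.Barriers.QuantumAdvantage.jozsaLinden2003_pblocked` (`BoundedEntanglement.lean`;
Jozsa–Linden 2003, §3). The classical simulation of lemma `ratpbl` updates a block description
gate by gate: "Case 1: the gate acts on two qubits which are already in the same block. Thus (a)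
[the block locations] remains unchanged …; Case 2: the 2-qubit gate straddles two existing blocks
`B₁` and `B₂` … we need to identify a new block structure … within the qubits of `B₁` and `B₂`"
(proof of lemma `ratpbl`). The soundness of keeping all *other* blocks is the locality of a
placed gate with respect to the splitting sets of `BoundedEntanglementSplitting.lean`:

* `Splits.placeGate_mulVec` / `Splits.placeGate_mulVec_of_disjoint` — applying an operator
  placed on wires inside `S` (or inside `Sᶜ`) to a state that splits across `(S, Sᶜ)` yields a
  state that splits across `(S, Sᶜ)` (no unitarity needed);
* `mem_atom_iff_of_splits` — inside a splitting set `C`, the atoms are cut out by the splitting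
  subsets of `C` alone (what the re-blocking step searches; that the atom lies inside `C` is
  `atom_subset_of_splits` of `BoundedEntanglementSplitting.lean`);
* the step structure of the catalogue's `QCircuitFamily.stateAfter`: `stateAfter_zero`,
  `stateAfter_succ` (one more gate = one placed matrix), `stateAfter_of_length_le`,
  `runOn_eq_stateAfter`, `normSq_stateAfter` (unit vectors, Clifford+`T` being unitary) and
  `stateAfter_ne_zero`;
* `HasPBlockedStates.card_atom_stateAfter_le` — under the hypothesis of theorem `pblthm`, every
  atom of every intermediate state has at most `p` wires.

## References

* R. Jozsa, N. Linden, *On the role of entanglement in quantum-computational speed-up*, Proc. R.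
  Soc. Lond. A 459 (2003) 2011–2032, arXiv:quant-ph/0201143: §3, proof of lemma `ratpbl`
  (Cases 1 and 2), theorem `pblthm`.
* M. A. Nielsen, I. L. Chuang, *Quantum Computation and Quantum Information*, CUP 2010, §4.3
  (a gate on a subset of the wires acts as `U ⊗ 1`), §2.1.7 eq. (2.45).
-/

noncomputable section

namespace Literature.Barriers.QuantumAdvantage

open Finset Matrix Literature.Computability.Cryptography Literature.Computability.QuantumComplexity

variable {N k : ℕ}

/-! ### Locality of placed operators -/

/-- Overwriting two configurations that agree on `S` along the same wires (all inside or all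
outside `S` is irrelevant here) gives configurations that agree on `S`. [folklore] -/
theorem extend_agree (E : Fin k ↪ Fin N) (z : QReg k) {x y : QReg N} {S : Set (Fin N)}
    (hxy : ∀ i ∈ S, x i = y i) : ∀ i ∈ S, Function.extend E z x i = Function.extend E z y i := by
  intro i hi
  by_cases hir : i ∈ Set.range E
  · obtain ⟨j, rfl⟩ := hir
    rw [E.injective.extend_apply, E.injective.extend_apply]
  · rw [extend_apply_of_not_mem E z x hir, extend_apply_of_not_mem E z y hir]
    exact hxy i hi

/-- **Locality (inside).** If `ψ` splits across `(S, Sᶜ)` and the operator `U` is placed on wires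
inside `S`, then `U_E ψ` splits across `(S, Sᶜ)`: `(U ⊗ 1)(e ⊗ f) = (U e) ⊗ f`. No unitarity is
needed. This is why a gate inside a block (Case 1), or inside the union of the two blocks it
straddles (Case 2), leaves all other blocks of the description untouched.
[cite: JozsaLinden2003, §3 (proof of lemma ratpbl, Cases 1 and 2)] -/
theorem Splits.placeGate_mulVec {ψ : QReg N → ℂ} {S : Finset (Fin N)} (h : Splits ψ S)
    (E : Fin k ↪ Fin N) (hE : ∀ j, E j ∈ S) (U : Matrix (QReg k) (QReg k) ℂ) :
    Splits (placeGate E U *ᵥ ψ) S := by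
  obtain ⟨e, f, he, hf, hψ⟩ := h
  refine ⟨fun x => ∑ z : QReg k, U (x ∘ E) z * e (Function.extend E z x), f, ?_, hf, ?_⟩
  · intro x y hxy
    change ∑ z, U (x ∘ E) z * e (Function.extend E z x) =
      ∑ z, U (y ∘ E) z * e (Function.extend E z y)
    have hxE : x ∘ E = y ∘ E := funext fun j => hxy (E j) (hE j)
    refine Finset.sum_congr rfl fun z _ => ?_
    rw [hxE, he (extend_agree E z hxy)]
  · intro x
    rw [placeGate_mulVec_apply, Finset.sum_mul]
    refine Finset.sum_congr rfl fun z _ => ?_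
    rw [hψ (Function.extend E z x), hf (x := Function.extend E z x) (y := x) ?_]
    · ring
    · intro i hi
      apply extend_apply_of_not_mem
      rintro ⟨j, rfl⟩
      exact hi (hE j)

/-- **Locality (outside).** If `ψ` splits across `(S, Sᶜ)` and `U` is placed on wires outside
`S`, then `U_E ψ` splits across `(S, Sᶜ)`. [cite: JozsaLinden2003, §3 (proof of lemma ratpbl, Cases 1 and 2)] -/
theorem Splits.placeGate_mulVec_of_disjoint {ψ : QReg N → ℂ} {S : Finset (Fin N)}
    (h : Splits ψ S) (E : Fin k ↪ Fin N) (hE : ∀ j, E j ∉ S) (U : Matrix (QReg k) (QReg k) ℂ) :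
    Splits (placeGate E U *ᵥ ψ) S :=
  splits_compl_iff.1 (h.compl.placeGate_mulVec E (fun j => mem_compl.2 (hE j)) U)

/-- **Locality of splitting sets away from the gate.** A set containing all the wires of the
placed operator, or avoiding them all, splits `U_E ψ` as soon as it splits `ψ`.
[cite: JozsaLinden2003, §3 (proof of lemma ratpbl, Cases 1 and 2)] -/
theorem Splits.placeGate_mulVec_of_subset_or_disjoint {ψ : QReg N → ℂ} {S : Finset (Fin N)}
    (h : Splits ψ S) (E : Fin k ↪ Fin N) (hE : (∀ j, E j ∈ S) ∨ ∀ j, E j ∉ S)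
    (U : Matrix (QReg k) (QReg k) ℂ) : Splits (placeGate E U *ᵥ ψ) S :=
  hE.elim (fun h' => h.placeGate_mulVec E h' U) fun h' => h.placeGate_mulVec_of_disjoint E h' U

/-! ### Atoms inside a splitting set -/

/-- **Re-blocking is local.** If `C` splits `ψ` and `i ∈ C`, the atom of `i` is cut out by the
splitting *subsets of `C`* alone: `j ∈ atom ψ i` iff `j` lies in every splitting `S ⊆ C`
containing `i` (intersect an arbitrary splitting set with `C`). This is the search space of the
re-blocking step ("a new block structure … within the qubits of `B₁` and `B₂`").
[cite: JozsaLinden2003, §3 (proof of lemma ratpbl, Case 2)] -/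
theorem mem_atom_iff_of_splits {ψ : QReg N → ℂ} {C : Finset (Fin N)} (hC : Splits ψ C) {i j : Fin N}
    (hi : i ∈ C) : j ∈ atom ψ i ↔ ∀ S ⊆ C, Splits ψ S → i ∈ S → j ∈ S := by
  constructor
  · exact fun h S _ hS hiS => mem_atom.1 h S hS hiS
  · intro h
    refine mem_atom.2 fun S hS hiS => ?_
    exact (mem_inter.1 (h (S ∩ C) inter_subset_right (hS.inter hC) (mem_inter.2 ⟨hiS, hi⟩))).1

/-- Atoms avoiding the wires of a placed operator, inside a splitting set avoiding them, still
split after the gate (they need not stay atoms, but they stay blocks of a product decomposition,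
of the same size). [cite: JozsaLinden2003, §3 (proof of lemma ratpbl, Cases 1 and 2)] -/
theorem splits_placeGate_mulVec_atom {ψ : QReg N → ℂ} (E : Fin k ↪ Fin N) {i : Fin N}
    (hE : ∀ j, E j ∉ atom ψ i) (U : Matrix (QReg k) (QReg k) ℂ) :
    Splits (placeGate E U *ᵥ ψ) (atom ψ i) :=
  (splits_atom ψ i).placeGate_mulVec_of_disjoint E hE U

/-! ### The intermediate states of a circuit family -/

section StateAfter

variable {G : QGateSet} (F : QCircuitFamily G) (x : List Bool)

/-- Before any gate the state is the padded input basis state `|x⟩|0…0⟩`.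
[cite: JozsaLinden2003, §2 (the computational model: input extended by zeroes)] -/
theorem stateAfter_zero : F.stateAfter x 0 = basisState (padInput x.get (F.ancillas x.length)) := by
  simp [QCircuitFamily.stateAfter, QCircuit.runOn]

/-- **One more gate is one placed matrix**: for `j` below the size, the state after `j + 1`
gates is the `j`-th gate matrix applied to the state after `j` gates.
[cite: JozsaLinden2003, §3 ("`|α_{j+1}⟩` is obtained by applying the 2-qubit gate `U_{i_j}`")] -/
theorem stateAfter_succ {j : ℕ} (hj : j < (F.circ x.length).gates.length) :
    F.stateAfter x (j + 1) = ((F.circ x.length).gates[j]).toMatrix 0 *ᵥ F.stateAfter x j := by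
  simp only [QCircuitFamily.stateAfter, QCircuit.runOn]
  rw [List.take_succ_eq_append_getElem hj,
    show (⟨(F.circ x.length).gates.take j ++ [(F.circ x.length).gates[j]]⟩ : QCircuit G _) =
      (⟨(F.circ x.length).gates.take j⟩ : QCircuit G _).append ⟨[(F.circ x.length).gates[j]]⟩
      from rfl,
    QCircuit.toMatrix_append, QCircuit.toMatrix_cons, QCircuit.toMatrix_nil, one_mul,
    Matrix.mulVec_mulVec]

/-- Beyond the size the state is the final state. [folklore] -/
theorem stateAfter_of_length_le {j : ℕ} (hj : (F.circ x.length).gates.length ≤ j) :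
    F.stateAfter x j = F.stateAfter x (F.circ x.length).gates.length := by
  simp only [QCircuitFamily.stateAfter, List.take_of_length_le hj, List.take_length]

/-- The final state of the family on `x` (empty oracle) is the state after all gates. [folklore] -/
theorem runOn_eq_stateAfter :
    (F.circ x.length).runOn 0 (basisState (padInput x.get (F.ancillas x.length))) =
      F.stateAfter x (F.circ x.length).gates.length := by
  simp only [QCircuitFamily.stateAfter, List.take_length]

/-- Over a unitary gate set every intermediate state is a unit vector. [cite: NielsenChuang2010, §2.1.6] -/
theorem normSq_stateAfter (hG : G.IsUnitary) (j : ℕ) : normSq (F.stateAfter x j) = 1 :=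
  QCircuit.normSq_runOn_basisState hG 0 _ _

/-- Hence no intermediate state is the zero vector. [folklore] -/
theorem stateAfter_ne_zero (hG : G.IsUnitary) (j : ℕ) : F.stateAfter x j ≠ 0 := by
  intro h
  have h1 := normSq_stateAfter F x hG j
  rw [h] at h1
  simp [normSq] at h1

/-- Clifford+`T` instance: the intermediate states of a Clifford+`T` family are unit vectors. [cite: NielsenChuang2010, §2.1.6] -/
theorem normSq_stateAfter_cliffordT (F : QCircuitFamily cliffordT) (x : List Bool) (j : ℕ) :
    normSq (F.stateAfter x j) = 1 :=
  normSq_stateAfter F x cliffordT_isUnitary_holds j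

end StateAfter

/-! ### The hypothesis of theorem `pblthm`, atom by atom -/

/-- Under `HasPBlockedStates p`, on a nonempty register every atom of every intermediate state has
at most `p` wires (the form in which the simulation uses the hypothesis: the re-blocked pieces
are atoms, hence small). [cite: JozsaLinden2003, §3 (theorem pblthm, hypothesis)] -/
theorem _root_.Literature.Computability.Cryptography.QCircuitFamily.HasPBlockedStates.card_atom_stateAfter_le
    {G : QGateSet} {p : ℕ} {F : QCircuitFamily G} (h : F.HasPBlockedStates p) (x : List Bool)
    (j : ℕ) (i : Fin (x.length + F.ancillas x.length)) : (atom (F.stateAfter x j) i).card ≤ p :=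
  (h x j).card_atom_le i

/-- Conversely the simulation only ever needs this atom form: on `N ≥ 1` wires it is equivalent
to the hypothesis. [cite: JozsaLinden2003, §3 (theorem pblthm, hypothesis)] -/
theorem hasPBlockedStates_iff_card_atom_le {G : QGateSet} {p : ℕ} {F : QCircuitFamily G}
    (hN : ∀ n, 0 < n + F.ancillas n) :
    F.HasPBlockedStates p ↔
      ∀ (x : List Bool) (j : ℕ) (i : Fin (x.length + F.ancillas x.length)),
        (atom (F.stateAfter x j) i).card ≤ p :=
  ⟨fun h x j i => h.card_atom_stateAfter_le x j i,
    fun h x j => isPBlocked_of_card_atom_le (hN x.length) (h x j)⟩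

end Literature.Barriers.QuantumAdvantage

end
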